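import Summits.KontsevichZagierPeriods.KontsevichZagierPeriods.Theorems.SoloInformedAlgBoxSplit
import Summits.KontsevichZagierPeriods.KontsevichZagierPeriods.Theorems.SoloInformedAlgDominant
import HarnessLib

/-!
# The first denominator beyond the `ℚ`-calculus: `(2x₀² − 1)² + x₁`, split at `x₀ = 1/√2`

Solo programme `solo-KontsevichZagierPeriods-informed`, session s107, step 10 (the payoff of the
re-base of the DEN-calculus on real-algebraic coefficient fields `K`).

`Q = (2x₀² − 1)² + x₁` is positive on the open square and vanishes on the closed square exactly
at the EDGE point `(1/√2, 0)`, whose abscissa is irrational.  The initial form for the weight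
`(0, 1)` is `(2x₀² − 1)²`, which vanishes inside the edge, so `Q` is cube-degenerate, no vertex
reflection or diagonal chart moves the zero to a vertex, and RULE SPLIT over `ℚ`
(`SoloInformedToricBoxSplit`) cannot cut at `x₀ = 1/√2`.  Over a field `K ∋ c` with
`2c² = 1`, `c > 0`:

* cut at `x₀ = c` (RULE SPLIT over `K`, `soloInformed_presentableDenK_of_split`);
* left half `Q(c·x₀, x₁) = (x₀² − 1)² + x₁` — zero at the vertex `(1, 0)`; the reflection
  `x₀ ↦ 1 − x₀` gives `x₀²(2 − x₀)² + x₁ = 4x₀² − 4x₀³ + x₀⁴ + x₁`, cube-nondegenerate by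
  LEMMA DOM over `K` (RULE VERTEX′ + RULE ND);
* right half `Q(c + (1−c)x₀, x₁) = 8(1−c)²x₀² + 16c(1−c)³x₀³ + 4(1−c)⁴x₀⁴ + x₁` (using
  `2c² = 1`) — zero at the origin, cube-nondegenerate by LEMMA DOM over `K` (RULE ND).

Hence **`(2x₀² − 1)² + x₁` is a presentable denominator over every such `K`**
(`soloInformed_presentableDenK_twoSqDen`), in particular over the field of real algebraic numbers
with `c = √2/2` (`soloInformed_presentableDenK_twoSqDen_algebraicClosure`), and every
`[ [0,1]², P/Q ]`, `P ∈ \overline{ℚ}∩ℝ [x₀, x₁]`, has the cube-crux resolution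
(`soloInformed_cubeResolution_twoSqDen`).

References: M. Kontsevich, D. Zagier, *Periods* (2001) §1.1–1.2; J. Ayoub, EMS Newsl. 91 (2014)
§2.2.
-/

noncomputable section

open scoped BigOperators
open MeasureTheory Set
open Literature.NumberTheory.Transcendental Literature.NumberTheory.Transcendental.KZ

namespace Summit.KontsevichZagierPeriods.KontsevichZagierPeriods.Theorems

variable {K : Type*} [Field K] [Algebra K ℝ]

/-! ### The denominator -/

variable (K) in
/-- The denominator `(2x₀² − 1)² + x₁ ∈ K[x₀, x₁]`. -/
def soloInformedTwoSqDen : MvPolynomial (Fin 2) K :=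
  (2 * MvPolynomial.X 0 ^ 2 - 1) ^ 2 + MvPolynomial.X 1

/-- Evaluation of `soloInformedTwoSqDen`. -/
theorem soloInformed_aeval_twoSqDen (x : Fin 2 → ℝ) :
    (MvPolynomial.aeval x (soloInformedTwoSqDen K) : ℝ) = (2 * x 0 ^ 2 - 1) ^ 2 + x 1 := by
  simp [soloInformedTwoSqDen]

/-- `(2x₀² − 1)² + x₁ > 0` on the open square. -/
theorem soloInformed_aeval_twoSqDen_pos {x : Fin 2 → ℝ} (hx : x ∈ soloInformedOpenCube 2) :
    0 < (MvPolynomial.aeval x (soloInformedTwoSqDen K) : ℝ) := by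
  rw [soloInformed_aeval_twoSqDen]
  nlinarith [(hx 1).1, sq_nonneg (2 * x 0 ^ 2 - 1)]

/-- The zero `(√2/2, 0)` of `(2x₀² − 1)² + x₁` on the closed square … -/
theorem soloInformed_aeval_twoSqDen_sqrt_two_div_two :
    (MvPolynomial.aeval ![Real.sqrt 2 / 2, 0] (soloInformedTwoSqDen K) : ℝ) = 0 := by
  rw [soloInformed_aeval_twoSqDen]
  have h2 : Real.sqrt 2 ^ 2 = 2 := Real.sq_sqrt (by norm_num)
  simp only [Matrix.cons_val_zero, Matrix.cons_val_one, div_pow, h2]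
  norm_num

/-- … has an irrational abscissa. -/
theorem soloInformed_irrational_sqrt_two_div_two : Irrational (Real.sqrt 2 / 2) := by
  simpa using irrational_sqrt_two.div_natCast (m := 2) two_ne_zero

/-! ### The two halves of the cut at `x₀ = c`, `2c² = 1` -/

/-- `2c² = 1`, `c > 0` force `c < 1`. -/
theorem soloInformed_twoSq_c_lt_one {c : K} (hc : 2 * algebraMap K ℝ c ^ 2 = 1)
    (hc0 : 0 < algebraMap K ℝ c) : algebraMap K ℝ c < 1 := by
  nlinarith [hc, hc0]

/-- The left half `Q(c·x₀, x₁)` is the vertex-moved (`x₀ ↦ 1 − x₀`) polynomial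
`4x₀² − 4x₀³ + x₀⁴ + x₁`. [this work] -/
theorem soloInformed_aeval_twoSqDen_left {c : K} (hc : 2 * algebraMap K ℝ c ^ 2 = 1)
    (x : Fin 2 → ℝ) :
    (MvPolynomial.aeval x (soloInformedScaleSubstK 0 0 c (soloInformedTwoSqDen K)) : ℝ) =
      MvPolynomial.aeval (soloInformedVertexMove {0} x) (soloInformedSqQuadAddX (4 : K) (-4) 1) := by
  rw [soloInformed_aeval_scaleSubstK, soloInformed_aeval_twoSqDen, soloInformed_aeval_sqQuadAddX,
    soloInformed_scaleMoveR_apply_self,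
    soloInformed_scaleMoveR_apply_ne 0 _ _ x (show (1 : Fin 2) ≠ 0 from by decide)]
  simp only [soloInformedVertexMove, Finset.mem_singleton, if_true,
    show (1 : Fin 2) ≠ 0 from by decide, if_false, map_zero, zero_add, map_ofNat, map_neg, map_one]
  linear_combination (2 * algebraMap K ℝ c ^ 2 * x 0 ^ 2 + x 0 ^ 2 - 2) * x 0 ^ 2 * hc

/-- The right half `Q(c + (1−c)x₀, x₁)` is `8(1−c)²x₀² + 16c(1−c)³x₀³ + 4(1−c)⁴x₀⁴ + x₁`
(here `2c² = 1` is used). [this work] -/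
theorem soloInformed_aeval_twoSqDen_right {c : K} (hc : 2 * algebraMap K ℝ c ^ 2 = 1)
    (x : Fin 2 → ℝ) :
    (MvPolynomial.aeval x (soloInformedScaleSubstK 0 c (1 - c) (soloInformedTwoSqDen K)) : ℝ) =
      MvPolynomial.aeval x (soloInformedSqQuadAddX (8 * (1 - c) ^ 2 : K)
        (16 * c * (1 - c) ^ 3) (4 * (1 - c) ^ 4)) := by
  rw [soloInformed_aeval_scaleSubstK, soloInformed_aeval_twoSqDen, soloInformed_aeval_sqQuadAddX,
    soloInformed_scaleMoveR_apply_self,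
    soloInformed_scaleMoveR_apply_ne 0 _ _ x (show (1 : Fin 2) ≠ 0 from by decide)]
  simp only [map_mul, map_pow, map_sub, map_one, map_ofNat]
  linear_combination (2 * algebraMap K ℝ c ^ 2 - 1 +
    8 * algebraMap K ℝ c * (1 - algebraMap K ℝ c) * x 0 +
    12 * (1 - algebraMap K ℝ c) ^ 2 * x 0 ^ 2) * hc

/-- The reflected left half `4x₀² − 4x₀³ + x₀⁴ + x₁ = x₀²(2 − x₀)² + x₁` is cube-nondegenerate
(LEMMA DOM over `K`). [this work] -/
theorem soloInformed_cubeNondegenerateK_twoSqDen_left :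
    SoloInformedCubeNondegenerateK (soloInformedSqQuadAddX (4 : K) (-4) 1) := by
  refine soloInformed_cubeNondegenerateK_sqQuadAddX (4 : K) (-4) 1 ?_ fun t _ ht1 => ?_
  · rw [map_ofNat]; norm_num
  · simp only [map_ofNat, map_neg, map_one, one_mul]
    nlinarith [ht1]

/-- The right half is cube-nondegenerate (LEMMA DOM over `K`; all its coefficients are positive
because `0 < c < 1`). [this work] -/
theorem soloInformed_cubeNondegenerateK_twoSqDen_right {c : K}
    (hc : 2 * algebraMap K ℝ c ^ 2 = 1) (hc0 : 0 < algebraMap K ℝ c) :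
    SoloInformedCubeNondegenerateK (soloInformedSqQuadAddX (8 * (1 - c) ^ 2 : K)
      (16 * c * (1 - c) ^ 3) (4 * (1 - c) ^ 4)) := by
  have hd : 0 < 1 - algebraMap K ℝ c := sub_pos.2 (soloInformed_twoSq_c_lt_one hc hc0)
  refine soloInformed_cubeNondegenerateK_sqQuadAddX _ _ _ ?_ fun t ht0 _ => ?_
  · simp only [map_mul, map_pow, map_sub, map_one, map_ofNat]
    positivity
  · simp only [map_mul, map_pow, map_sub, map_one, map_ofNat]
    have h1 : 0 < 8 * (1 - algebraMap K ℝ c) ^ 2 := by positivity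
    have h2 : 0 ≤ 16 * algebraMap K ℝ c * (1 - algebraMap K ℝ c) ^ 3 * t :=
      mul_nonneg (mul_nonneg (mul_nonneg (by norm_num) hc0.le) (pow_nonneg hd.le 3)) ht0
    have h3 : 0 ≤ 4 * (1 - algebraMap K ℝ c) ^ 4 * t ^ 2 := by positivity
    linarith

/-- **`(2x₀² − 1)² + x₁` is a presentable denominator** over every real-algebraic coefficient
field `K` containing `c > 0` with `2c² = 1`: RULE SPLIT at `x₀ = c`, RULE VERTEX′ + RULE ND on
the left half, RULE ND on the right half. [this work] -/
theorem soloInformed_presentableDenK_twoSqDen (hK : ∀ a : K, IsAlgebraic ℚ (algebraMap K ℝ a))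
    {c : K} (hc : 2 * algebraMap K ℝ c ^ 2 = 1) (hc0 : 0 < algebraMap K ℝ c) :
    SoloInformedPresentableDenK (soloInformedTwoSqDen K) := by
  have hc1 := soloInformed_twoSq_c_lt_one hc hc0
  refine soloInformed_presentableDenK_of_split hK 0 c hc0 hc1
    (fun x hx _ => (soloInformed_aeval_twoSqDen_pos hx).ne') ?_ ?_
  · -- left half: RULE VERTEX′ with `B = 4x₀² − 4x₀³ + x₀⁴ + x₁`
    refine soloInformed_presentableDenK_of_eq_vertexMove hK {0}
      (soloInformed_presentableDenK_of_nondegenerate hK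
        soloInformed_cubeNondegenerateK_twoSqDen_left)
      (fun x hx => ?_) fun x _ => soloInformed_aeval_twoSqDen_left hc x
    rw [soloInformed_aeval_sqQuadAddX]
    simp only [map_ofNat, map_neg, map_one, one_mul]
    nlinarith [(hx 1).1, sq_nonneg (x 0 * (2 - x 0))]
  · -- right half: RULE ND
    exact soloInformed_presentableDenK_congr
      (fun x _ => (soloInformed_aeval_twoSqDen_right hc x).symm)
      (soloInformed_presentableDenK_of_nondegenerate hK
        (soloInformed_cubeNondegenerateK_twoSqDen_right hc hc0))

/-! ### Over the field of real algebraic numbers -/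

/-- `√2/2` is a real algebraic number. -/
theorem soloInformed_isAlgebraic_sqrt_two_div_two : IsAlgebraic ℚ (Real.sqrt 2 / 2) := by
  refine IsAlgebraic.of_pow two_pos ?_
  have h : (Real.sqrt 2 / 2) ^ 2 = algebraMap ℚ ℝ (1 / 2) := by
    rw [div_pow, Real.sq_sqrt (by norm_num)]
    norm_num
  rw [h]
  exact isAlgebraic_algebraMap _

/-- `√2/2` as an element of the field of real algebraic numbers. -/
def soloInformedSqrtTwoDivTwo : algebraicClosure ℚ ℝ :=
  ⟨Real.sqrt 2 / 2, mem_algebraicClosure_iff.2 soloInformed_isAlgebraic_sqrt_two_div_two⟩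

/-- Its real value. -/
theorem soloInformed_algebraMap_sqrtTwoDivTwo :
    algebraMap (algebraicClosure ℚ ℝ) ℝ soloInformedSqrtTwoDivTwo = Real.sqrt 2 / 2 := rfl

/-- **`(2x₀² − 1)² + x₁ ∈ (\overline{ℚ} ∩ ℝ)[x₀, x₁]` is a presentable denominator**: the split
at the irrational algebraic abscissa `x₀ = √2/2`. [this work] -/
theorem soloInformed_presentableDenK_twoSqDen_algebraicClosure :
    SoloInformedPresentableDenK (soloInformedTwoSqDen (algebraicClosure ℚ ℝ)) := by
  have h2 : Real.sqrt 2 ^ 2 = 2 := Real.sq_sqrt (by norm_num)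
  refine soloInformed_presentableDenK_twoSqDen soloInformed_algCoeff_algebraicClosure
    (c := soloInformedSqrtTwoDivTwo) ?_ ?_
  · rw [soloInformed_algebraMap_sqrtTwoDivTwo, div_pow, h2]; norm_num
  · rw [soloInformed_algebraMap_sqrtTwoDivTwo]; positivity

/-- **The cube crux for `P/((2x₀² − 1)² + x₁)`**, `P` with real algebraic coefficients: every
`IntegralRep` on `[0,1]²` with this integrand on the open square has the resolution
`of r ∈ ℤ-span of realised cube germs + relations` (`k = 1`). [this work] -/
theorem soloInformed_cubeResolution_twoSqDen (P : MvPolynomial (Fin 2) (algebraicClosure ℚ ℝ))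
    (r : IntegralRep 2) (hr : r.domain = soloInformedCube 2)
    (hri : EqOn r.integrand (fun x => (MvPolynomial.aeval x P : ℝ) /
      MvPolynomial.aeval x (soloInformedTwoSqDen (algebraicClosure ℚ ℝ))) (soloInformedOpenCube 2)) :
    ∃ (k : ℕ) (_ : k ≠ 0) (m' : ℕ) (d : Fin m' → ℕ) (G : ∀ j, SoloInformedCubeGerm (d j))
      (c : Fin m' → ℤ) (ρ : ∀ j, IntegralRep (d j)),
      (∀ j, (ρ j).domain = soloInformedCube (d j)) ∧
      (∀ j, EqOn (ρ j).integrand (fun x => ((G j).g (soloInformedToC (d j) x)).re)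
        (soloInformedCube (d j))) ∧
      k • of r - ∑ j, c j • of (ρ j) ∈ relations :=
  soloInformed_cubeResolution_of_presentableDenK
    soloInformed_presentableDenK_twoSqDen_algebraicClosure P r hr hri

end Summit.KontsevichZagierPeriods.KontsevichZagierPeriods.Theorems
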